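import Mathlib
import Summits.ABC.ABC.Theses.DefiniteXi

/-!
# Sketch (stub-ideation k3 gen 7) — the one NEW typed statement: forced congruence primes

Instrument behind the census law `forced_dvd_cps` (`Cruxes/SteinbergCore/P6MersenneCensusCertG7.lean`): a LOWER-bound
statement on the prime-to-6 part of the modular degree, hence NOT a step toward the stub (an upper
bound) — recorded so the stub-critic can see exactly what the Family-3 mechanism pass produced.
Sources: Ribet 1990 (Invent. Math. 100) Thm 1.1 (level lowering at a multiplicative prime `q`, `ℓ ∣ v_q(Δ_min)`,
`ρ̄_{E,ℓ}` irreducible — automatic for Frey curves and `ℓ ≥ 5` by Mazur + full rational 2-torsion);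
Agashe–Ribet–Stein 2012 Thm 2.2 (`ord_ℓ(deg) = ord_ℓ(congruence number)` when `ℓ² ∤ N`; tree named facts
`Literature.NumberTheory.EllipticCurves.modularDegree_dvd_congruenceNumber`,
`Literature.NumberTheory.EllipticCurves.padicValNat_congruenceNumber_eq_of_not_sq_dvd`).
-/

set_option linter.dupNamespace false

namespace Summit.ABC.ABC.Cruxes.SteinbergCore.StubIdeas3G7

open Literature.NumberTheory.EllipticCurves Literature.NumberTheory.EllipticCurves.ModularForms

/-- **ForcedPrimeDvdDeg** (M modulo the two ARS named facts + Ribet 1990 as a named fact; instrument only).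
For a Frey curve `E_{a,b}` of conductor `N`, a prime `q ∥ N` (multiplicative) and a prime `ℓ ≥ 5` with
`ℓ ∣ v_q(Δ_min)`, EVERY modular parametrisation `X₀(N) → E_{a,b}` has degree divisible by `ℓ`
(`deg D = deg ψ · deg π_opt`, and `ℓ ∣ deg π_opt` by Ribet + ARS since `ℓ² ∤ N ∣ 2⁸ rad(abc)`). -/
def ForcedPrimeDvdDeg : Prop :=
  ∀ a b : ℤ, IsCoprime a b → a * b * (a + b) ≠ 0 → ∀ (N : ℕ) [NeZero N],
    (freyCurve a b).conductorNorm ℤ = N →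
    ∀ q : ℕ, q.Prime → q ∣ N → ¬ q ^ 2 ∣ N →
    ∀ ℓ : ℕ, ℓ.Prime → 5 ≤ ℓ → ℓ ∣ ((freyCurve a b).minimalDiscriminantNorm ℤ).factorization q →
    ∀ D : ModularParametrizationData (freyCurve a b) N, ℓ ∣ D.deg

/-- Its only consequence for the stub's quantity: a lower bound `ℓ ∣ cps(deg D)` (since `ℓ ∤ 6`), i.e. the
forced primes are a factor of `cps(deg_min)` of size `≤ cps(rad ∏_{q ∥ N} v_q(Δ_min))` — negligible against
`N^{2+ε}` and against stub 3's allowance; the sporadic (new-at-every-`q`) congruence primes carry the content. -/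
theorem forced_dvd_primeToSix (h : ForcedPrimeDvdDeg) :
    ∀ a b : ℤ, IsCoprime a b → a * b * (a + b) ≠ 0 → ∀ (N : ℕ) [NeZero N],
    (freyCurve a b).conductorNorm ℤ = N →
    ∀ q : ℕ, q.Prime → q ∣ N → ¬ q ^ 2 ∣ N →
    ∀ ℓ : ℕ, ℓ.Prime → 5 ≤ ℓ → ℓ ∣ ((freyCurve a b).minimalDiscriminantNorm ℤ).factorization q →
    ∀ D : ModularParametrizationData (freyCurve a b) N, ℓ ∣ D.deg / (ordProj[2] D.deg * ordProj[3] D.deg) := by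
  intro a b hab h0 N _ hN q hq hqN hq2 ℓ hℓ h5 hdvd D
  have hℓD : ℓ ∣ D.deg := h a b hab h0 N hN q hq hqN hq2 ℓ hℓ h5 hdvd D
  -- `ℓ` is coprime to `2^{v₂} 3^{v₃}` (ℓ ≥ 5 prime), and that six-part divides `D.deg`.
  have h6dvd : ordProj[2] D.deg * ordProj[3] D.deg ∣ D.deg := by
    have hcop : Nat.Coprime (ordProj[2] D.deg) (ordProj[3] D.deg) := by
      apply Nat.Coprime.pow _ _ (by norm_num : Nat.Coprime 2 3)
    exact hcop.mul_dvd_of_dvd_of_dvd (Nat.ordProj_dvd _ _) (Nat.ordProj_dvd _ _)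
  have hℓ2 : Nat.Coprime ℓ (ordProj[2] D.deg) := by
    apply Nat.Coprime.pow_right
    exact (Nat.coprime_primes hℓ Nat.prime_two).mpr (by omega)
  have hℓ3 : Nat.Coprime ℓ (ordProj[3] D.deg) := by
    apply Nat.Coprime.pow_right
    exact (Nat.coprime_primes hℓ Nat.prime_three).mpr (by omega)
  have hcop6 : Nat.Coprime ℓ (ordProj[2] D.deg * ordProj[3] D.deg) := Nat.Coprime.mul_right hℓ2 hℓ3
  set s : ℕ := ordProj[2] D.deg * ordProj[3] D.deg with hs
  obtain ⟨m, hm⟩ := h6dvd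
  have hpos : 0 < s := by positivity
  have hdiv : D.deg / s = m := Nat.div_eq_of_eq_mul_right hpos hm
  rw [hdiv]
  have : ℓ ∣ s * m := hm ▸ hℓD
  exact hcop6.dvd_of_dvd_mul_left this

end Summit.ABC.ABC.Cruxes.SteinbergCore.StubIdeas3G7
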